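import Summits.Ventures.Crystal3D.Theorems.StickyWulffConstantGenericWallFloorEndBallClassDefs
import Summits.Ventures.Crystal3D.Theorems.StickyWulffConstantGenericWallFloorEndBallPayerBound
import HarnessLib

/-!
# THE §51 INTERFACE (theorems): soundness of the site verdicts and the consuming kernel theorem «every ball within √3 of a carrier
# is the centre, a listed ball, a ball at a free site, or payer-accompanied» (crux `GenericWallFloor`, stmt-Ventures-19480, line `WallLedgerG`)

HONEST FRAMING. Venture `Summits/Ventures/Crystal3D` (cell `crystal3d-full`), helper `--supports` the crux `GenericWallFloor` of
`route-Ventures-StickyWulffConstant`, REGISTERED line `WallLedgerG`, open stub `stub_twoSlabAdhesion`.  Rung credit only; F-C1 not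
moved; NOT the crux.  Census-free, standard axioms; GAP/CLASSIFICATION (`δ ≥ 5/2`) are hypotheses as upstream (…EndBallUniverse).
The one-screen §51 INTERFACE is the module docstring of `…GenericWallFloorEndBallClassDefs`; this file proves it:
* §2 site geometry: `pointVec_zero/_injective`, `site_injective`, `dist_sq_sites`, `dist_sq_centre_site`, `dist_centre_site_eq_one`;
  **`EndBallClass.not_mem_of_overlaps`** (verdict `overlap` is sound by `1`-separation), `EndBallClass.length_contacts_le`,
  **`EndBallClass.not_mem_of_extraContact`** (verdict `extraContact` is sound under the sharp shell row `deg z ≤ |contacts|`).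
* §3 **`EndBallClass.universe`** (core), **`EndBallClass.universe_sharp`** (shell row `deg z ≤ |contacts|`, free sites
  `C.freeSites true`), **`EndBallClass.universe_count`** (`deg z ≤ |contacts| + 1`, free sites `C.freeSites false`): every `x ∈ X` with
  `dist x z ≤ √3` around a carrier `z` of a well-formed class `C` is `z`, a listed ball `z + A·pointVec q` (`q ∈ contacts ∪ own`), a
  ball at a FREE site (`q ∈ C.freeSites _`), or has a payer `y ≠ z` within `2` (`deg y ≤ 11`; multiplicity constants in
  …EndBallPayerBound) — via `mem_menuQ3_or_payer_of_near_endBall` (…EndBallMenuTable).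
WHAT THIS IS NOT: no class is enumerated or certified here; F-C1 not moved.
-/

noncomputable section

namespace Summit.Ventures.Crystal3D.Theorems

open Summit.Ventures.Crystal3D Finset NearIdentity
open scoped InnerProductSpace

/-! ### §2 Geometry of sites -/

variable {X : Finset (EuclideanSpace ℝ (Fin 3))}

/-- `pointVec 0 = 0`. -/
theorem pointVec_zero : pointVec (0 : Fin 3 → ℤ) = 0 := by
  have h := pointVec_sub 0 0
  rwa [sub_self, sub_self] at h

/-- `pointVec` is injective. -/
theorem pointVec_injective : Function.Injective pointVec := by
  intro a b h
  have hc := congrArg cubicCoords h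
  rw [cubicCoords_pointVec, cubicCoords_pointVec] at hc
  funext k
  have hk := congrFun hc k
  have hs : (3 * Real.sqrt 2 : ℝ) ≠ 0 := by positivity
  have : (a k : ℝ) = b k := (div_left_inj' hs).1 hk
  exact_mod_cast this

/-- Sites are injective in `q`: `z + A·pointVec q = z + A·pointVec p ⇒ q = p`. -/
theorem site_injective (A : EuclideanSpace ℝ (Fin 3) ≃ₗᵢ[ℝ] EuclideanSpace ℝ (Fin 3)) (z : EuclideanSpace ℝ (Fin 3)) :
    Function.Injective fun q : Fin 3 → ℤ => z + A (pointVec q) :=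
  fun _ _ h => pointVec_injective (A.injective (add_left_cancel h))

/-- Squared distance between two sites: `dist (z + A·pointVec q) (z + A·pointVec p)² = sdot3 (q − p) (q − p) / 18`. -/
theorem dist_sq_sites (A : EuclideanSpace ℝ (Fin 3) ≃ₗᵢ[ℝ] EuclideanSpace ℝ (Fin 3)) (z : EuclideanSpace ℝ (Fin 3))
    (q p : Fin 3 → ℤ) :
    dist (z + A (pointVec q)) (z + A (pointVec p)) ^ 2 = (sdot3 (q - p) (q - p) : ℝ) / 18 := by
  rw [dist_eq_norm, add_sub_add_left_eq_sub, ← map_sub, LinearIsometryEquiv.norm_map, ← pointVec_sub, norm_sq_pointVec]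

/-- Squared distance of a site from the centre: `dist z (z + A·pointVec q)² = sdot3 q q / 18`. -/
theorem dist_sq_centre_site (A : EuclideanSpace ℝ (Fin 3) ≃ₗᵢ[ℝ] EuclideanSpace ℝ (Fin 3)) (z : EuclideanSpace ℝ (Fin 3))
    (q : Fin 3 → ℤ) : dist z (z + A (pointVec q)) ^ 2 = (sdot3 q q : ℝ) / 18 := by
  rw [dist_eq_norm, sub_add_cancel_left, norm_neg, LinearIsometryEquiv.norm_map, norm_sq_pointVec]

/-- A site of squared length `18` is at distance `1` from the centre. -/
theorem dist_centre_site_eq_one (A : EuclideanSpace ℝ (Fin 3) ≃ₗᵢ[ℝ] EuclideanSpace ℝ (Fin 3)) (z : EuclideanSpace ℝ (Fin 3))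
    {q : Fin 3 → ℤ} (h18 : sdot3 q q = 18) : dist z (z + A (pointVec q)) = 1 := by
  have h := dist_sq_centre_site A z q
  rw [h18] at h
  have h1 : dist z (z + A (pointVec q)) ^ 2 = 1 := by rw [h]; norm_num
  exact (pow_eq_one_iff_of_nonneg dist_nonneg two_ne_zero).1 h1

/-- **Verdict `overlap` is sound:** no ball of a `1`-separated `X` sits at an overlapping site of a carrier. -/
theorem EndBallClass.not_mem_of_overlaps (C : EndBallClass) (hX : ∀ p ∈ X, ∀ q ∈ X, p ≠ q → 1 ≤ dist p q)
    (A : EuclideanSpace ℝ (Fin 3) ≃ₗᵢ[ℝ] EuclideanSpace ℝ (Fin 3)) {z : EuclideanSpace ℝ (Fin 3)} (hcar : C.IsCarrier X A z)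
    {q : Fin 3 → ℤ} (hq0 : q ≠ 0) (hov : C.overlaps q = true) : z + A (pointVec q) ∉ X := by
  intro hqX
  rw [EndBallClass.overlaps, Bool.or_eq_true, decide_eq_true_eq, List.any_eq_true] at hov
  rcases hov with hlt | ⟨p, hp, hpq⟩
  · have hne : z ≠ z + A (pointVec q) := by
      intro h
      have h' : z + A (pointVec 0) = z + A (pointVec q) := by rw [pointVec_zero, map_zero, add_zero]; exact h
      exact hq0 (site_injective A z h').symm
    have h1 := hX z hcar.1 _ hqX hne
    have h2 := dist_sq_centre_site A z q
    have hlt' : (sdot3 q q : ℝ) < 18 := by exact_mod_cast hlt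
    nlinarith [h1, h2, hlt']
  · rw [decide_eq_true_eq] at hpq
    obtain ⟨hpq, hlt⟩ := hpq
    have hpX : z + A (pointVec p) ∈ X := hcar.2 p hp
    have hne : z + A (pointVec q) ≠ z + A (pointVec p) := fun h => hpq (site_injective A z h).symm
    have h1 := hX _ hqX _ hpX hne
    have h2 := dist_sq_sites A z q p
    have hlt' : (sdot3 (q - p) (q - p) : ℝ) < 18 := by exact_mod_cast hlt
    nlinarith [h1, h2, hlt']

/-- For a well-formed class, `|contacts| ≤ |slotIdx|`. -/
theorem EndBallClass.length_contacts_le (C : EndBallClass) (hwf : C.wf = true) : C.contacts.length ≤ C.slotIdx.card := by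
  classical
  rw [EndBallClass.wf, Bool.and_eq_true, List.all_eq_true] at hwf
  obtain ⟨hslots, hnodup⟩ := hwf
  have hnodup' : C.contacts.Nodup := of_decide_eq_true hnodup
  have hsub : C.contacts.toFinset ⊆ C.slotIdx.image fun i => 3 • slotInt i := by
    intro q hq
    have hq' := List.mem_toFinset.1 hq
    have hmem : q ∈ dozenQ3 none := of_decide_eq_true (hslots q hq')
    obtain ⟨i, -, rfl⟩ := Finset.mem_image.1 hmem
    exact Finset.mem_image.2 ⟨i, Finset.mem_filter.2 ⟨Finset.mem_univ _, hq'⟩, rfl⟩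
  calc C.contacts.length = C.contacts.toFinset.card := (List.toFinset_card_of_nodup hnodup').symm
    _ ≤ (C.slotIdx.image fun i => 3 • slotInt i).card := Finset.card_le_card hsub
    _ ≤ C.slotIdx.card := Finset.card_image_le

/-- **Verdict `extraContact` is sound under the SHARP shell row:** an unlisted site at distance `1` is empty when
`deg z ≤ |contacts|`. -/
theorem EndBallClass.not_mem_of_extraContact (C : EndBallClass) (hwf : C.wf = true)
    (A : EuclideanSpace ℝ (Fin 3) ≃ₗᵢ[ℝ] EuclideanSpace ℝ (Fin 3)) {z : EuclideanSpace ℝ (Fin 3)} (hcar : C.IsCarrier X A z)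
    (hsharp : (X.filter fun y => dist z y = 1).card ≤ C.contacts.length)
    {q : Fin 3 → ℤ} (hq : q ∉ C.contacts) (h18 : sdot3 q q = 18) : z + A (pointVec q) ∉ X := by
  classical
  intro hqX
  rw [EndBallClass.wf, Bool.and_eq_true, List.all_eq_true] at hwf
  obtain ⟨hslots, hnodup⟩ := hwf
  have hnodup' : C.contacts.Nodup := of_decide_eq_true hnodup
  have h18' : ∀ p ∈ q :: C.contacts, sdot3 p p = 18 := by
    intro p hp
    rcases List.mem_cons.1 hp with rfl | hp
    · exact h18
    · exact ((sdot3_dozenQ3 none) p (of_decide_eq_true (hslots p hp))).1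
  have hmemX : ∀ p ∈ q :: C.contacts, z + A (pointVec p) ∈ X := by
    intro p hp
    rcases List.mem_cons.1 hp with rfl | hp
    · exact hqX
    · exact hcar.2 p (List.mem_append_left _ hp)
  have hnd : (q :: C.contacts).Nodup := List.nodup_cons.2 ⟨hq, hnodup'⟩
  have hTsub : ((q :: C.contacts).toFinset.image fun p => z + A (pointVec p)) ⊆ X.filter fun y => dist z y = 1 := by
    intro y hy
    obtain ⟨p, hp, rfl⟩ := Finset.mem_image.1 hy
    have hp' := List.mem_toFinset.1 hp
    exact Finset.mem_filter.2 ⟨hmemX p hp', dist_centre_site_eq_one A z (h18' p hp')⟩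
  have hTcard : ((q :: C.contacts).toFinset.image fun p => z + A (pointVec p)).card = C.contacts.length + 1 := by
    rw [Finset.card_image_of_injective _ (site_injective A z), List.toFinset_card_of_nodup hnd, List.length_cons]
  have := Finset.card_le_card hTsub
  omega

/-! ### §3 The consuming theorem -/

/-- **THE §51 KERNEL THEOREM (core form).**  GAP(`δ`) ∧ CLASSIFICATION(`δ`), `δ ≥ 5/2`; `X` `1`-separated; `C` a well-formed class;
`z` a carrier of `C` in the frame `A`; the shell row in count form `deg z ≤ |contacts| + 1`, and in sharp form `deg z ≤ |contacts|`
when `sharp = true`.  Then every `x ∈ X` with `dist x z ≤ √3` is the centre, a listed ball, a ball at a free site of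
`C.freeSites sharp`, or has a payer `y ∈ X`, `y ≠ z`, `dist x y ≤ 2`, `deg y ≤ 11`. -/
theorem EndBallClass.universe (C : EndBallClass) (hwf : C.wf = true) {δ : ℝ} (hg : KissingGap δ)
    (hc : KissingClassification δ) (hδ : 5 / 2 ≤ δ) (hX : ∀ p ∈ X, ∀ q ∈ X, p ≠ q → 1 ≤ dist p q)
    (A : EuclideanSpace ℝ (Fin 3) ≃ₗᵢ[ℝ] EuclideanSpace ℝ (Fin 3)) {z : EuclideanSpace ℝ (Fin 3)} (hcar : C.IsCarrier X A z)
    (sharp : Bool) (hrow : (X.filter fun y => dist z y = 1).card ≤ C.contacts.length + 1)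
    (hsharp : sharp = true → (X.filter fun y => dist z y = 1).card ≤ C.contacts.length)
    {x : EuclideanSpace ℝ (Fin 3)} (hx : x ∈ X) (h3 : dist x z ≤ Real.sqrt 3) :
    x = z ∨ (∃ q ∈ C.listed, x = z + A (pointVec q)) ∨ (∃ q ∈ C.freeSites sharp, x = z + A (pointVec q)) ∨
      ∃ y ∈ X, y ≠ z ∧ dist x y ≤ 2 ∧ (X.filter fun q => dist y q = 1).card ≤ 11 := by
  classical
  by_cases hxz : x = z
  · exact Or.inl hxz
  right
  have hSX : ∀ i ∈ C.slotIdx, z + A (slotSite i) ∈ X := by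
    intro i hi
    rw [slotSite_eq_pointVec]
    exact hcar.2 _ (List.mem_append_left _ (Finset.mem_filter.1 hi).2)
  have hdeg : (X.filter fun y => dist z y = 1).card ≤ C.slotIdx.card + 1 :=
    hrow.trans (by have := C.length_contacts_le hwf; omega)
  rcases mem_menuQ3_or_payer_of_near_endBall hg hc hδ hX A hcar.1 C.slotIdx hSX hdeg hx hxz h3 with hpay | ⟨q, hq, hxq⟩
  · exact Or.inr (Or.inr hpay)
  by_cases hlisted : q ∈ C.listed
  · exact Or.inl ⟨q, hlisted, hxq⟩
  right; left
  have hq0 : q ≠ 0 := by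
    rintro rfl
    exact hxz (by rw [hxq, pointVec_zero, map_zero, add_zero])
  refine ⟨q, Finset.mem_filter.2 ⟨hq, ?_, hq0, hlisted, ?_, ?_⟩, hxq⟩
  · have h := dist_sq_centre_site A z q
    rw [← hxq, dist_comm] at h
    have h3' : dist x z ^ 2 ≤ 3 := by
      calc dist x z ^ 2 ≤ Real.sqrt 3 ^ 2 := pow_le_pow_left₀ dist_nonneg h3 2
        _ = 3 := Real.sq_sqrt (by norm_num)
    have : (sdot3 q q : ℝ) ≤ 54 := by rw [h] at h3'; linarith
    exact_mod_cast this
  · by_contra hov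
    have hov' : C.overlaps q = true := by simpa using hov
    exact C.not_mem_of_overlaps hX A hcar hq0 hov' (hxq ▸ hx)
  · intro hs h18
    have hqc : q ∉ C.contacts := fun h => hlisted (List.mem_append_left _ h)
    exact C.not_mem_of_extraContact hwf A hcar (hsharp hs) hqc h18 (hxq ▸ hx)

/-- **§51 kernel theorem, SHARP shell row** (`deg z ≤ |contacts|`, cf-p2's `ShellRowHolds` certificate): free sites
`C.freeSites true` (extra contacts excluded). -/
theorem EndBallClass.universe_sharp (C : EndBallClass) (hwf : C.wf = true) {δ : ℝ} (hg : KissingGap δ)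
    (hc : KissingClassification δ) (hδ : 5 / 2 ≤ δ) (hX : ∀ p ∈ X, ∀ q ∈ X, p ≠ q → 1 ≤ dist p q)
    (A : EuclideanSpace ℝ (Fin 3) ≃ₗᵢ[ℝ] EuclideanSpace ℝ (Fin 3)) {z : EuclideanSpace ℝ (Fin 3)} (hcar : C.IsCarrier X A z)
    (hrow : (X.filter fun y => dist z y = 1).card ≤ C.contacts.length)
    {x : EuclideanSpace ℝ (Fin 3)} (hx : x ∈ X) (h3 : dist x z ≤ Real.sqrt 3) :
    x = z ∨ (∃ q ∈ C.listed, x = z + A (pointVec q)) ∨ (∃ q ∈ C.freeSites true, x = z + A (pointVec q)) ∨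
      ∃ y ∈ X, y ≠ z ∧ dist x y ≤ 2 ∧ (X.filter fun q => dist y q = 1).card ≤ 11 :=
  C.universe hwf hg hc hδ hX A hcar true (Nat.le_succ_of_le hrow) (fun _ => hrow) hx h3

/-- **§51 kernel theorem, COUNT form** (`deg z ≤ |contacts| + 1` only): free sites `C.freeSites false` (extra-contact sites stay
in the table). -/
theorem EndBallClass.universe_count (C : EndBallClass) (hwf : C.wf = true) {δ : ℝ} (hg : KissingGap δ)
    (hc : KissingClassification δ) (hδ : 5 / 2 ≤ δ) (hX : ∀ p ∈ X, ∀ q ∈ X, p ≠ q → 1 ≤ dist p q)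
    (A : EuclideanSpace ℝ (Fin 3) ≃ₗᵢ[ℝ] EuclideanSpace ℝ (Fin 3)) {z : EuclideanSpace ℝ (Fin 3)} (hcar : C.IsCarrier X A z)
    (hrow : (X.filter fun y => dist z y = 1).card ≤ C.contacts.length + 1)
    {x : EuclideanSpace ℝ (Fin 3)} (hx : x ∈ X) (h3 : dist x z ≤ Real.sqrt 3) :
    x = z ∨ (∃ q ∈ C.listed, x = z + A (pointVec q)) ∨ (∃ q ∈ C.freeSites false, x = z + A (pointVec q)) ∨
      ∃ y ∈ X, y ≠ z ∧ dist x y ≤ 2 ∧ (X.filter fun q => dist y q = 1).card ≤ 11 :=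
  C.universe hwf hg hc hδ hX A hcar false hrow (fun h => Bool.noConfusion h) hx h3

end Summit.Ventures.Crystal3D.Theorems

end
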